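import Literature.NumberTheory.EllipticCurves.KellerYin2024.CharacterSelmerGroups
import Literature.NumberTheory.EllipticCurves.Agboola2007.RestrictedSelmerGroups
import HarnessLib

/-!
# Choi–Kezuka–Li 2019, Lemma 5.1: for `p` split in an imaginary quadratic field `K` with `p ∤ h_K`, the
# split-prime `ℤ_p`-extension `K_∞` has NO non-trivial abelian `p`-extension unramified outside the primes
# above `𝔭` (`X(K_∞) = 0`; e.g. `K = ℚ(√−7)`, `p = 2`) — ONE named fact

Topic `NumberTheory/IwasawaTheory` (namespace = path, paper sub-namespace `ChoiKezukaLi2019`). STATEMENT ONLY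
(`def … : Prop`, D-0014; +1 declared debt: global class field theory for the ray class tower modulo `𝔭^n`
and topological Nakayama, neither in the tree in this form); no `sorry`, no `instance`, no notation. Typed by
the `bsd-2adic` cell (seat `bsd-2adic-t42` GEN 36) as the optional sharpening (F3) of the GL(1) leaf
`TrivialCharSplitLineFiniteAt` of crux O2 (stmt-BirchSwinnertonDyer-24728) on habitat (β)'s field `ℚ(√−7)`;
BSD is proved for no curve by this; typed ≠ proved.

## The printed statement (held text `paper:arxiv-1711.01697`, arXiv numbering)

J. Choi, Y. Kezuka, Y. Li, *Analogues of Iwasawa's `μ = 0` conjecture and the weak Leopoldt conjecture for a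
non-cyclotomic `ℤ₂`-extension*, Asian J. Math. 23 (2019) 383–400 [ChoiKezukaLi2019]. §5 (p0012 L3–15):
"we point out the following well-known general lemma. **Lemma 5.1.** Let `K` be an imaginary quadratic
field, and `p` any rational prime which splits in `K` and does not divide the class number of `K`. Let `K_∞`
be the unique `ℤ_p`-extension of `K` unramified outside one of the primes `𝔭` of `K` above `p`. Then `K_∞`
has no non-trivial abelian `p`-extension unramified outside the primes above `𝔭`. *Proof.* … let `X(K_∞)`
be the Galois group over `K_∞` of the maximal abelian `p`-extension of `K_∞` unramified outside the primes
above `𝔭`. Then, as usual in Iwasawa theory, we have `X(K_∞)_Γ = Gal(R/K_∞)` where `R` denotes the maximal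
abelian `p`-extension which is unramified outside `𝔭`. … as `p` does not divide `h`, class field theory
tells us that `Gal(R/K)` must be the maximal pro-`p` quotient of `lim← ((𝒪/𝔭^n)^×/{±1})` which is
isomorphic to `ℤ_p`. Thus `R = K_∞`, and the proof of the lemma is complete by Nakayama's lemma."
p0012 L18: "Clearly, the assumption of the above lemma is valid for our situation when `p = 2` and
`K = ℚ(√−q)` with `q` any prime congruent to `7` modulo `8`. The simplest example is given by
`K = ℚ(√−7)`, which has class number `1`, in which case `X(H_∞) = X(K_∞) = 0`." (Context, §1 p0003
L15–24: "`X(H_∞) = Gal(M(H_∞)/H_∞)` … it has long been known that `X(H_∞)` is a finitely generated torsion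
module over `Λ(Γ)`. … **Theorem 1.1.** The Galois group `X(H_∞)` is a finitely generated `ℤ₂`-module.")

## What is typed

* `ChoiKezukaLi2019.lemma51_splitPrime_iwasawaModule_subsingleton` — THE NAMED FACT, on the objects of
  `Greenberg1978.splitPrime_iwasawaModule_finite_torsion` (file `SplitPrimeIwasawaModuleTorsion.lean`; dictionary there: `κ` THE `ℤ_p`-line of `K`
  unramified outside `v`; `X` any Pontryagin-dual datum of `H¹_{nr outside v}(K_∞, ℚ_p/ℤ_p) = X(K_∞)^∨`,
  `X ≅ X(K_∞)` as a group): if `p ∤ h_K` (`NumberField.classNumber K`) then `X` is trivial (`Subsingleton`).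
  (For `K` imaginary quadratic the only prime above `𝔭 = v` in `K` is `v`; "unramified outside the primes
  above `𝔭`" over `K_∞` = the tree's conditions at every place not above `v`.)
-- TODO(general form): Thm. 1.1 / Cor. 1.2 of the source (`X(H_∞)`, `X(J_∞)` finitely generated over `ℤ₂`
-- for the Hilbert class field `H` of `ℚ(√−q)`, `q ≡ 7 mod 8`, and its quadratic extensions `J`) concern
-- the RELATIVE towers `H K_∞/H`, `J K_∞/J`; not transcribed (needs the restriction of `κ` to `Γ_H`).

References: [ChoiKezukaLi2019] Lemma 5.1 (arXiv:1711.01697 p0012 L5–15), p0012 L18, Thm. 1.1 (p0003 L23–24);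
[Greenberg1978] §4; [deShalit1987] II.4.17.
-/

noncomputable section

open scoped Classical

open NumberField IsDedekindDomain Field
open Literature.NumberTheory.EllipticCurves Literature.NumberTheory.EllipticCurves.GreenbergSelmer
  Literature.NumberTheory.EllipticCurves.GreenbergVatsal2000 Literature.NumberTheory.GaloisRepresentations

namespace Literature.NumberTheory.IwasawaTheory.ChoiKezukaLi2019

/-- **Choi–Kezuka–Li 2019, Lemma 5.1 ("well-known")**: for an imaginary quadratic field `K`, a prime
`p = v v̄` SPLIT in `K` (`v ≠ v̄` above `p`) NOT dividing the class number `h_K`, the `ℤ_p`-extension `κ` of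
`K` unramified outside `v` with a topological generator `γ`, and ANY Pontryagin-dual datum `X` of
`H¹_{nr outside v}(K_∞, ℚ_p/ℤ_p) = X(K_∞)^∨`: `X ≅ X(K_∞) = Gal(M(K_∞)/K_∞)` is TRIVIAL — "`K_∞` has no
non-trivial abelian `p`-extension unramified outside the primes above `𝔭`". Instance in print: `p = 2`,
`K = ℚ(√−7)` (`h_K = 1`, `2` split): `X(K_∞) = 0` (p0012 L18). Named fact (ray class field theory modulo
`𝔭^n` + Nakayama).
[cite: ChoiKezukaLi2019, Lemma 5.1 (arXiv:1711.01697 p0012 L5–15) and p0012 L18] -/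
def lemma51_splitPrime_iwasawaModule_subsingleton : Prop :=
  ∀ (K : Type) [Field K] [NumberField K] (_hK : IsImaginaryQuadratic K) (p : ℕ) [Fact p.Prime]
    (_hh : ¬ p ∣ NumberField.classNumber K)
    (v vbar : HeightOneSpectrum (𝓞 K)) (_hv : ((p : ℕ) : 𝓞 K) ∈ v.asIdeal)
    (_hvbar : ((p : ℕ) : 𝓞 K) ∈ vbar.asIdeal) (_hne : vbar ≠ v)
    (κ : ZpExtension K p) (_hκ : κ.IsUnramifiedOutside v)
    (γ : absoluteGaloisGroup K) (_hγ : κ.IsTopGenerator γ)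
    (X : DatumDualData κ γ
      (KellerYin2024.charModule (∅ : Set (PadicAlgCl p))
        (1 : FramedGaloisRep K (padicCoeffIntegers (∅ : Set (PadicAlgCl p))) 1))
      (Castella2018.AcSelmer.bdpData
        (KellerYin2024.charModule (∅ : Set (PadicAlgCl p))
        (1 : FramedGaloisRep K (padicCoeffIntegers (∅ : Set (PadicAlgCl p))) 1)) p vbar) ∅),
    Subsingleton X.X

end Literature.NumberTheory.IwasawaTheory.ChoiKezukaLi2019

end
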